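import Summits.QuantumFields.YangMills.Theorems.BalabanUVNodesN18KingModelEndDecay
import Summits.QuantumFields.YangMills.Theorems.BalabanUVNodesN18EndCarriersLineSums

/-!
# BalabanUVNodes ∕ N18 — ALL LINES READ: King's (4.42) three-factor graphs at EVERY pair of blocks of EVERY localization
# domain, on the END's carriers `torusCarriers N W` ∕ `reFunctional N W` (`TwoRunTorusNE5Final*`): `NE5` with exponent
# `κρ∕2`, rate `L^{−γ∕2}`; the read-back geometry; the non-vacuity of the selection reading (Track A, DAG node N18 = NE5
# `T4OutputRate.NE5 EA EB W κ θ C₅` :211; director-ym R134 row n18 s3 «King-model transfer `N18KingModelTorus` (κ, C₅ from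
# (d, L, a, m², γ)) → `TwoRunTorusNE5Final*`», module 3 of seat pub-ymgap-dag-n18-e)

HONEST FRAMING.  Count-neutral kernel bookkeeping (seat pub-ymgap-dag-n18-e g3, strategy s3; `--supports
stmt-QuantumFields-19676` = K3 `SpineGivenEndpointR11`).  King's `A = 0` scalar MODEL ([King1986], printed and proved,
typed by seats n18-a∕n18-b) — NOT Bałaban's covariant one-step outputs `E^{(j)}(X; g, U_k(V))` of [Balaban1987RG1]
(0.24)∕(2.13), for which NE5 is NOT IN PRINT and has no tree producer (NODE O instance 0∕1); NOT a node discharge; finite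
tori; nothing continuum ∕ ℝ⁴ ∕ OS ∕ mass-gap ∕ Clay.  THEOREMS ONLY: 0 `def`, 0 `sorry`, standard axioms.

THE POINT.  Module 1 (`N18KingModelEndDecay`, p458808) reads ONE line (one pair of points) per live domain and says so
under «WHAT THIS DOES NOT DO»; module 2 (`N18EndCarriersLineSums`, p459720) proves GENERICALLY that polynomially many
located lines per domain cost half the exponent (`ne5_reFunctional_of_cubePairs`).  This file is the King INSTANCE of
module 2 §5 — the lines are ALL pairs `(p, q)` of cubes of each domain `X ∈ 𝐃_j`, each carrying King's ACTUAL (4.42) graph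
of run A (level `j + 1`) and of run B (level `j + 1 + n`) between fine points of the blocks `p`, `q` when the line is LIVE
(`X` is a connecting polymer of the pair: `ρ·d_j(X) ≤ |p − q|_{T₁}`), the same value in both runs when it is dead
([Balaban1985UV3] p. 262: *"The localizations {□_j} and the walks ω replacing lines of the graph define a localization X …
simply a union of all these sets"*) — with the geometry making the dictionary «two-point kernel with torus-distance decay ↔
polymer activity with tree-length decay» two-way at the level of lines:
* §1 TORUS GEOMETRY (d, N general; folklore, PROVED): `tdistT_le_one_of_tadj`, `exists_nat_eq_tdistT`,
  `exists_mem_tdistT_eq` (DISCRETE INTERMEDIATE VALUES along a chain of cubes: every integer `k ≤ |p − b|_{T₁}` is the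
  distance from `p` of some cube of the family), **`tdistT_add_one_le_card`** (`|p − q|_{T₁} + 1 ≤ |X|` for a
  face-connected `X ∋ p, q`), and with (2.30)'s lower half (`TreeLengthTorus.card_le_torusTreeLen`)
  **`tdistT_le_torusTreeLen_affine`**: `|p − q|_{T₁} ≤ 4·2^d·d_j(X) + 2^d − 1` for EVERY `X ∈ 𝐃_j ∋ p, q` — the READ-BACK
  direction (module 1 §1 `exists_connecting_tdom` is the forward one: SOME `X ∋ p, q` has `d_j(X) ≤ d·|p − q|_{T₁}`).
* §2 **`ne5_kingModel_endCarriers_allLines`** — `∃ κ > 0, C₅ ≥ 0` (the letters of p418046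
  `N18KingModelTorus.ne5_kingModel_threeFactor_torus`, functions of `d, L, a, m², γ` ONLY) such that for every `n ≥ 1`,
  Bałaban volumes `L·M_k(μ) = 2L^{m_k}`, END data `N, W`, LIVE predicate on LINES `l = (⟨j, X⟩, (p, q))`, ratio `ρ > 0`,
  line readings `x_A l, y_A l` (King level `j + 1`) under `x_B l, y_B l` located on live lines
  (`ρ·d_j(X) ≤ |B(x_A l) − B(y_A l)|_{T₁}`), line contributions `G_A l, G_B l` equal to King's ACTUAL (4.42) three-factor
  graphs of the two runs on live lines and to EACH OTHER on dead lines, and real families with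
  `K_A X − K_B X = Σ_{(p,q) ∈ X×X} (G_A − G_B)(⟨j, X⟩, (p, q))`:
  `NE5 (torusCarriers N W) (reFunctional … K_A) (reFunctional … K_B) W′ (κρ∕2) (L^{−γ∕2}) (C₅·(4·2^4)²·(2!(2∕(κρ))²e^{κρ∕2}))`
  — p418046 on LINE-indexed auxiliary carriers (module 1 §2's `min` device), `θ^{j+1} ≤ θ^j`, then module 2 §5 BY NAME;
  `allLines_letters`: the letters have content (`κρ∕2 > 0`, `0 < L^{−γ∕2} < 1` for `γ > 0`).
* §3 NON-VACUITY (d = 4, ρ = 1∕4; `TPt 4 (L·M) = Tor (fine L M)` definitionally): **`exists_selection_reading`** — at every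
  scale `j` a SELECTION `Xsel (p, q) ∈ 𝐃_j ∋ p, q` with `¼·d_j ≤ |p − q|_{T₁}` (module 1 §3 `exists_live_domain`) and
  BASE-POINT readings with `B(x_A (p, q)) = p`, `B(y_A (p, q)) = q` (`King1986.Torus.site` ∕ `val_site` ∕ `blockOf_site`):
  declaring `(⟨j, X⟩, (p, q))` live iff `X = Xsel (p, q)`, §2's binders `hx`, `hy`, `hloc` hold jointly and EVERY pair of
  blocks of the torus is a live line of exactly its selected domain.
* §4 READ-BACK: **`kingShape_of_locatedLine`** — `v ≤ C·θ^j·e^{−κ′·d_j(X)}` at ANY `X ∈ 𝐃_j ∋ p, q` gives King's shape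
  `v ≤ C·e^{κ′(2^d − 1)∕(4·2^d)}·θ^j·e^{−(κ′∕(4·2^d))·|p − q|_{T₁}}`: [King1986] (3.73)'s `e^{−δ₀|x − y|}` and
  [Balaban1987RG1] (0.25)'s `e^{−κd_j(X)}` are equivalent up to letters, line by line.
WHAT THIS DOES NOT DO.  Lines are indexed by pairs of BLOCKS and read at one fine point per block (fine-point multiplicity
and King's (2.20)-rescaling `(L^jη)^{2−d−γ}` stay outside, as in the whole n18-a∕-e lineage); `A = 0`, `g`∕`U` unread
(no covariant King propagators in the tree); no vertex functions; NOT Bałaban's `E^{(j)}(X; g, U)`.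

Sources: C. King, Commun. Math. Phys. **102** (1986) 649–677 [King1986] — Prop. 3.9 (3.73) p. 665, (4.42)–(4.43) p. 675,
p. 664 («x′ ∈ B^n(x)»); T. Bałaban, Commun. Math. Phys. **109** (1987) 249–301 [Balaban1987RG1] — p. 257 (localization
domains, connected families, linear size `d_j(X)`), (0.24)–(0.25) p. 257, Thm 1 p. 259; **116** (1988) 1–22
[Balaban1988RG2Cluster] (2.30) p. 18; **102** (1985) 255–275 [Balaban1985UV3] p. 262.  No claim about the mass gap.
-/

noncomputable section

namespace Summit.QuantumFields.YangMills.BalabanUVNodes.N18KingModelAllLines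

open Matrix
open Literature.MathematicalPhysics.QuantumFieldTheory.Balaban1983to89
open Literature.MathematicalPhysics.QuantumFieldTheory.Balaban1983to89.T4OutputRate (Carriers NE5)
open Literature.MathematicalPhysics.QuantumFieldTheory.Balaban1983to89.B5Prop11Plancherel (Tor fine unitVec)
open Literature.MathematicalPhysics.QuantumFieldTheory.Balaban1983to89.TreeLengthTorus
  (TPt TAdj TStepIn TLinked TFaceConnected TDom torusTreeLen torusTreeLen_nonneg card_le_torusTreeLen tsys)
open Literature.MathematicalPhysics.QuantumFieldTheory.Balaban1983to89.B4TorusKernel.MultiPeriod (circAbs circAbs_nonneg)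
open Literature.MathematicalPhysics.QuantumFieldTheory.Balaban1983to89.B13Lemma3Torus (TwoTorusStep)
open Literature.MathematicalPhysics.QuantumFieldTheory.King1986 (aK)
open Literature.MathematicalPhysics.QuantumFieldTheory.King1986.Torus
  (minimiser effLaplacian blockProj blockOf site val_site blockOf_site tdistT tdistT_nonneg tdistT_symm
    tdistT_self tdistT_triangle tdistT_add_unitVec_le exists_coord_eq_tdistT tdistT_eq_zero_of_d)
open Summit.QuantumFields.BalabanUV.T4Continuum.Spine.NE5.TwoRunTorusNE5 (torusCarriers reFunctional)
open Summit.QuantumFields.YangMills.BalabanUVNodes.N18KingModel (kingTheta_pos kingTheta_le_one)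
open Summit.QuantumFields.YangMills.BalabanUVNodes.N18KingModelTorus (ne5_kingModel_threeFactor_torus)
open Summit.QuantumFields.YangMills.BalabanUVNodes.N18KingModelEndDecay (exists_live_domain)
open Summit.QuantumFields.YangMills.BalabanUVNodes.N18EndCarriersLineSums (ne5_reFunctional_of_cubePairs)

/-! ## §1 Torus geometry: the torus distance along a chain of cubes (d, N general) -/

section Geometry
variable {d N : ℕ} [NeZero N]

omit [NeZero N] in
/-- The cube `a + e_i (mod N)` written as a sum with the unit vector `e_i = Pi.single i 1`. [folklore] -/
theorem update_add_one_eq_add_unitVec (a : TPt d N) (i : Fin d) :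
    Function.update a i (a i + 1) = a + unitVec (fun _ : Fin d => N) i := by
  funext j
  by_cases hj : j = i
  · subst hj
    simp [unitVec]
  · simp [Function.update_of_ne hj, unitVec, Pi.single_eq_of_ne hj]

/-- **Wall-neighbours are at torus distance at most one**: `TAdj a b → |a − b|_{T₁} ≤ 1` (`tdistT` = the sup-circular
distance of `King1986.Torus` on `(ℤ∕N)^d = Tor (fun _ => N)`). [folklore] -/
theorem tdistT_le_one_of_tadj {a b : TPt d N} (h : TAdj a b) : tdistT (fun _ : Fin d => N) a b ≤ 1 := by
  obtain ⟨i, h | h⟩ := h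
  · rw [h, update_add_one_eq_add_unitVec]
    exact tdistT_add_unitVec_le (fun _ : Fin d => N) a i
  · rw [tdistT_symm, h, update_add_one_eq_add_unitVec]
    exact tdistT_add_unitVec_le (fun _ : Fin d => N) b i

/-- **The torus distance is a natural number** (a maximum of circular coordinate distances `dist(x_μ − y_μ, Nℤ) ∈ ℕ`).
[folklore] -/
theorem exists_nat_eq_tdistT (x y : TPt d N) : ∃ m : ℕ, tdistT (fun _ : Fin d => N) x y = m := by
  by_cases hd : d = 0
  · exact ⟨0, by rw [Nat.cast_zero]; exact tdistT_eq_zero_of_d (fun _ : Fin d => N) hd x y⟩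
  obtain ⟨μ, hμ⟩ := exists_coord_eq_tdistT (fun _ : Fin d => N) hd x y
  have hN : 1 ≤ N := Nat.one_le_iff_ne_zero.mpr (NeZero.ne N)
  have h0 : 0 ≤ circAbs N (((x μ).val : ℤ) - ((y μ).val : ℤ)) := circAbs_nonneg hN _
  refine ⟨(circAbs N (((x μ).val : ℤ) - ((y μ).val : ℤ))).toNat, ?_⟩
  rw [hμ]
  exact_mod_cast (Int.toNat_of_nonneg h0).symm

/-- **DISCRETE INTERMEDIATE VALUES ALONG A CHAIN OF CUBES.**  If `b` is chained to `p` inside the family `S` (`TLinked S p b`: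
consecutive cubes of `S` with common walls) and `p ∈ S`, then every natural number `k ≤ |p − b|_{T₁}` is the torus distance
from `p` of some cube of `S` — each step of the chain moves the (integer) distance from `p` by at most one
(`tdistT_le_one_of_tadj`, triangle inequality). [cite: Balaban1987RG1, p.257 (connected families of cubes)] -/
theorem exists_mem_tdistT_eq {S : Finset (TPt d N)} {p b : TPt d N} (hp : p ∈ S) (h : TLinked S p b) :
    ∀ k : ℕ, (k : ℝ) ≤ tdistT (fun _ : Fin d => N) p b → ∃ a ∈ S, tdistT (fun _ : Fin d => N) p a = k := by
  induction h with
  | refl =>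
    intro k hk
    rw [tdistT_self] at hk
    have hk0 : k = 0 := by exact_mod_cast le_antisymm hk (Nat.cast_nonneg k)
    exact ⟨p, hp, by rw [hk0, Nat.cast_zero]; exact tdistT_self _ p⟩
  | @tail b c _ hbc ih =>
    intro k hk
    by_cases hkb : (k : ℝ) ≤ tdistT (fun _ : Fin d => N) p b
    · exact ih k hkb
    · -- `|p − b| < k ≤ |p − c| ≤ |p − b| + 1` between integers forces `k = |p − c|`
      obtain ⟨mb, hmb⟩ := exists_nat_eq_tdistT p b
      obtain ⟨mc, hmc⟩ := exists_nat_eq_tdistT p c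
      have hstep : tdistT (fun _ : Fin d => N) p c ≤ tdistT (fun _ : Fin d => N) p b + 1 :=
        (tdistT_triangle _ p b c).trans (by have := tdistT_le_one_of_tadj hbc.2.2; linarith)
      rw [hmb] at hkb
      rw [hmc] at hk
      rw [hmb, hmc] at hstep
      have h1 : mb < k := by exact_mod_cast lt_of_not_ge hkb
      have h2 : k ≤ mc := by exact_mod_cast hk
      have h3 : mc ≤ mb + 1 := by exact_mod_cast hstep
      have hkc : k = mc := by omega
      exact ⟨c, hbc.2.1, by rw [hmc, hkc]⟩

/-- **A FACE-CONNECTED FAMILY CONTAINING TWO CUBES HAS AT LEAST `|p − q|_{T₁} + 1` CUBES**: the cubes of `X` at distances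
`0, 1, …, |p − q|_{T₁}` from `p` (`exists_mem_tdistT_eq`) are pairwise distinct. [cite: Balaban1987RG1, p.257 (connected families of cubes)] -/
theorem tdistT_add_one_le_card {X : Finset (TPt d N)} (hc : TFaceConnected X) {p q : TPt d N} (hp : p ∈ X)
    (hq : q ∈ X) : tdistT (fun _ : Fin d => N) p q + 1 ≤ X.card := by
  classical
  obtain ⟨m, hm⟩ := exists_nat_eq_tdistT p q
  have hlink : TLinked X p q := hc p hp q hq
  -- a cube of `X` at each distance `k ≤ m` from `p`
  have hsel : ∀ k : ℕ, k < m + 1 → ∃ a ∈ X, tdistT (fun _ : Fin d => N) p a = k := fun k hk =>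
    exists_mem_tdistT_eq hp hlink k (by rw [hm]; exact_mod_cast Nat.le_of_lt_succ hk)
  choose! f hfX hfd using hsel
  have hinj : Set.InjOn f ↑(Finset.range (m + 1)) := by
    intro k hk k' hk' hkk
    have h1 := hfd k (Finset.mem_range.1 hk)
    have h2 := hfd k' (Finset.mem_range.1 hk')
    rw [hkk] at h1
    exact_mod_cast h1.symm.trans h2
  have hmaps : Set.MapsTo f ↑(Finset.range (m + 1)) ↑X := fun k hk => hfX k (Finset.mem_range.1 hk)
  have hcard := Finset.card_le_card_of_injOn f hmaps hinj
  rw [Finset.card_range] at hcard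
  rw [hm]
  exact_mod_cast hcard

/-- **READ-BACK GEOMETRY: A LINE LOCATED AT A DOMAIN IS LOCATED IN THE BLOCK DISTANCE.**  For EVERY localization domain
`X ∈ 𝐃_j` (non-empty, torus-face-connected) containing the cubes `p, q`:
`|p − q|_{T₁} ≤ 4·2^d·d_j(X) + 2^d − 1` — `tdistT_add_one_le_card` with the lower half of (2.30) in its repaired form
`|X| ≤ 2^d(4d_j(X) + 1)` (`TreeLengthTorus.card_le_torusTreeLen`).  Converse companion of module 1 §1
`N18KingModelEndDecay.exists_connecting_tdom` (SOME domain `X ∋ p, q` has `d_j(X) ≤ d·|p − q|_{T₁}`).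
[cite: Balaban1988RG2Cluster, (2.30) p.18 (lower half, repaired form); Balaban1987RG1, p.257 (linear size d_j)] -/
theorem tdistT_le_torusTreeLen_affine (X : TDom d N) {p q : TPt d N} (hp : p ∈ X.1) (hq : q ∈ X.1) :
    tdistT (fun _ : Fin d => N) p q ≤ 4 * 2 ^ d * torusTreeLen X.1 + (2 ^ d - 1) := by
  have h1 := tdistT_add_one_le_card X.2.2 hp hq
  have h2 := card_le_torusTreeLen X.2.1 X.2.2
  linarith
end Geometry

/-! ## §2 All lines read: King's three-factor graphs at every pair of blocks of every domain, on the END's carriers -/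

section AllLines
variable {d : ℕ} {L' : ℕ} [NeZero L']

open Classical in
/-- **KING'S MODEL ON THE END'S CARRIERS, ALL LINES READ.**  For `d ≥ 1`, odd `L > 1`, `a > 0`, `m² > 0`, `0 ≤ γ ≤ 1` there
are `κ > 0`, `C₅ ≥ 0` — functions of `d, L, a, m², γ` ONLY (the letters of `N18KingModelTorus.ne5_kingModel_threeFactor_torus`)
— such that: for every `n ≥ 1`; every family of unit tori `L·M_k(μ) = 2L^{m_k}`; every END data `N, W`; every LIVE
predicate on the LINES `l = (⟨j, X⟩, (p, q))` (a domain `X ∈ 𝐃_j` and an ordered pair of cubes of the torus at scale `j`)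
and ratio `ρ > 0`; every reading, by lines, of run-A fine points `x_A l, y_A l` on King's level `j + 1` UNDER run B's
`x_B l, y_B l`, LOCATED on live lines: `ρ·d_j(X) ≤ |B(x_A l) − B(y_A l)|_{T₁}`; every two families of LINE CONTRIBUTIONS
`G_A, G_B` which on live lines are King's ACTUAL (4.42) three-factor graphs `Σ_{z,w} ℋ_{j+1}(x_A l, z)·C^{(j+1)}(z, w)·ℋ_{j+1}(y_A l, w)`
∕ `Σ_{z,w} ℋ_{j+1+n}(x_B l, z)·C^{(j+1+n)}(z, w)·ℋ_{j+1+n}(y_B l, w)` (`ℋ = minimiser`, `C^{(·)} = (effLaplacian + aL⁻²·blockProj)⁻¹`)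
and on dead lines AGREE; every two real families with `K_A X − K_B X = Σ_{(p,q) ∈ X×X} (G_A − G_B)(⟨j, X⟩, (p, q))`; every
window: `NE5 (torusCarriers N W) (reFunctional N W K_A) (reFunctional N W K_B) W′ (κρ∕2) (L^{−γ∕2}) (C₅·(4·2^4)²·(2!(2∕(κρ))²e^{κρ∕2}))`
— p418046 per line on the line-indexed auxiliary carriers (tree length `min(ρ·d_j(X), |B(x_A l) − B(y_A l)|_{T₁})`),
`θ^{j+1} ≤ θ^j`, dead lines `0`, then `N18EndCarriersLineSums.ne5_reFunctional_of_cubePairs` (the `≤ (4·2^4)²(d_j(X) + 1)²`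
lines of a domain cost half the exponent).  A = 0 MODEL; every line of every domain read.
[cite: King1986, Prop. 3.9 (3.73) p.665, (4.42)–(4.43) p.675; Balaban1987RG1, (0.24)-(0.25) p.257, Thm 1 p.259; Balaban1988RG2Cluster, (2.30) p.18; Balaban1985UV3, p.262] -/
theorem ne5_kingModel_endCarriers_allLines (hd : 1 ≤ d) (L : ℕ) [NeZero L] (hLp : Odd L ∧ 1 < L) {a m2 : ℝ}
    (ha : 0 < a) (hm : 0 < m2) {γ : ℝ} (hγ0 : 0 ≤ γ) (hγ1 : γ ≤ 1) :
    ∃ κ C₅ : ℝ, 0 < κ ∧ 0 ≤ C₅ ∧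
      ∀ (n : ℕ) (_hn : 1 ≤ n) (M : ℕ → Fin d → ℕ) [∀ k μ, NeZero (M k μ)]
        (_hM : ∀ k, ∃ mm : ℕ, ∀ μ, L * M k μ = 2 * L ^ mm)
        (N : ℕ → ℕ) [∀ j, NeZero (N j)] (W : (j : ℕ) → TwoTorusStep 4 L' (N j))
        (live : (Σ X : (Σ j : ℕ, TDom 4 (N j)), TPt 4 (N X.1) × TPt 4 (N X.1)) → Prop) (ρ : ℝ) (_hρ : 0 < ρ)
        (xA yA : (l : Σ X : (Σ j : ℕ, TDom 4 (N j)), TPt 4 (N X.1) × TPt 4 (N X.1)) →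
          Tor (fine (L ^ (l.1.1 + 1)) (fine L (M (l.1.1 + 1)))))
        (xB yB : (l : Σ X : (Σ j : ℕ, TDom 4 (N j)), TPt 4 (N X.1) × TPt 4 (N X.1)) →
          Tor (fine (L ^ n * L ^ (l.1.1 + 1)) (fine L (M (l.1.1 + 1)))))
        (_hx : ∀ l μ, (xA l μ).val = (xB l μ).val / L ^ n)
        (_hy : ∀ l μ, (yA l μ).val = (yB l μ).val / L ^ n)
        (_hloc : ∀ l, live l → ρ * torusTreeLen l.1.2.1 ≤ tdistT (fine L (M (l.1.1 + 1)))
            (blockOf (L ^ (l.1.1 + 1)) (fine L (M (l.1.1 + 1))) (xA l))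
            (blockOf (L ^ (l.1.1 + 1)) (fine L (M (l.1.1 + 1))) (yA l)))
        (GA GB : (Σ X : (Σ j : ℕ, TDom 4 (N j)), TPt 4 (N X.1) × TPt 4 (N X.1)) → ℝ)
        (_hGA : ∀ l, live l → GA l =
          (fun z => minimiser (L ^ (l.1.1 + 1)) (fine L (M (l.1.1 + 1))) (aK a L (l.1.1 + 1))
              (((L ^ (l.1.1 + 1) : ℕ) : ℝ) ^ 2) m2 (Pi.single z 1) (xA l))
            ⬝ᵥ ((effLaplacian (L ^ (l.1.1 + 1)) (fine L (M (l.1.1 + 1))) (aK a L (l.1.1 + 1))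
                    (((L ^ (l.1.1 + 1) : ℕ) : ℝ) ^ 2) m2
                  + (a * ((L : ℝ) ^ 2)⁻¹) • blockProj L (M (l.1.1 + 1)))⁻¹
                *ᵥ fun w => minimiser (L ^ (l.1.1 + 1)) (fine L (M (l.1.1 + 1))) (aK a L (l.1.1 + 1))
                    (((L ^ (l.1.1 + 1) : ℕ) : ℝ) ^ 2) m2 (Pi.single w 1) (yA l)))
        (_hGB : ∀ l, live l → GB l =
          (fun z => minimiser (L ^ n * L ^ (l.1.1 + 1)) (fine L (M (l.1.1 + 1))) (aK a L (l.1.1 + 1 + n))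
              (((L ^ n * L ^ (l.1.1 + 1) : ℕ) : ℝ) ^ 2) m2 (Pi.single z 1) (xB l))
            ⬝ᵥ ((effLaplacian (L ^ n * L ^ (l.1.1 + 1)) (fine L (M (l.1.1 + 1))) (aK a L (l.1.1 + 1 + n))
                    (((L ^ n * L ^ (l.1.1 + 1) : ℕ) : ℝ) ^ 2) m2
                  + (a * ((L : ℝ) ^ 2)⁻¹) • blockProj L (M (l.1.1 + 1)))⁻¹
                *ᵥ fun w => minimiser (L ^ n * L ^ (l.1.1 + 1)) (fine L (M (l.1.1 + 1))) (aK a L (l.1.1 + 1 + n))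
                    (((L ^ n * L ^ (l.1.1 + 1) : ℕ) : ℝ) ^ 2) m2 (Pi.single w 1) (yB l)))
        (_hdead : ∀ l, ¬ live l → GA l = GB l)
        (KA KB : (Σ j : ℕ, TDom 4 (N j)) → ℝ)
        (_hK : ∀ X, KA X - KB X = ∑ pq ∈ X.2.1 ×ˢ X.2.1, (GA ⟨X, pq⟩ - GB ⟨X, pq⟩))
        (W' : Set (ℕ → ℝ)),
        NE5 (C := torusCarriers N W) (reFunctional N W fun j X _ => ((KA ⟨j, X⟩ : ℝ) : ℂ))
          (reFunctional N W fun j X _ => ((KB ⟨j, X⟩ : ℝ) : ℂ)) W' (κ * ρ / 2) ((L : ℝ) ^ (-(γ / 2)))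
          (C₅ * (4 * 2 ^ 4) ^ 2 * (((2 : ℕ).factorial : ℝ) * (2 / (κ * ρ)) ^ 2 * Real.exp (κ * ρ / 2))) := by
  obtain ⟨κ, C₅, hκ, hC₅, H⟩ := ne5_kingModel_threeFactor_torus hd L hLp ha hm hγ0 hγ1
  refine ⟨κ, C₅, hκ, hC₅, ?_⟩
  intro n hn M _ hM N _ W live ρ hρ xA yA xB yB hx hy hloc GA GB hGA hGB hdead KA KB hK W'
  set θ : ℝ := (L : ℝ) ^ (-(γ / 2)) with hθ_def
  have hL1 : 1 ≤ L := by have := hLp.2; omega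
  have hθ0 : 0 ≤ θ := (kingTheta_pos hL1 (γ / 2)).le
  have hθ1 : θ ≤ 1 := kingTheta_le_one hL1 (by linarith)
  -- the LINE-indexed auxiliary carriers: King's level `j + 1`, tree length `min(ρ·d_j(X), block distance of the line)`
  let C' : Carriers :=
    { Dom := Σ X : (Σ j : ℕ, TDom 4 (N j)), TPt 4 (N X.1) × TPt 4 (N X.1), scale := fun l => l.1.1 + 1,
      d := fun l => min (ρ * torusTreeLen l.1.2.1) (tdistT (fine L (M (l.1.1 + 1)))
        (blockOf (L ^ (l.1.1 + 1)) (fine L (M (l.1.1 + 1))) (xA l))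
        (blockOf (L ^ (l.1.1 + 1)) (fine L (M (l.1.1 + 1))) (yA l))),
      d_nonneg := fun l => le_min (mul_nonneg hρ.le (torusTreeLen_nonneg _)) (tdistT_nonneg _ _ _),
      BgA := PUnit, BgB := PUnit, gauge := fun _ _ => 0, gauge_nonneg := fun _ _ => le_rfl, transport := id }
  -- King's (3.73) first bound for the ACTUAL (4.42) three-factor graphs on `C'` (p418046), every binder a read-out formula
  have h5 := H n hn M hM C' (fun _ => Nat.succ_le_succ (Nat.zero_le _)) xA yA xB yB hx hy
    (fun l => min_le_right _ _)
    (fun _ _ l => (fun z => minimiser (L ^ (l.1.1 + 1)) (fine L (M (l.1.1 + 1))) (aK a L (l.1.1 + 1))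
        (((L ^ (l.1.1 + 1) : ℕ) : ℝ) ^ 2) m2 (Pi.single z 1) (xA l))
      ⬝ᵥ ((effLaplacian (L ^ (l.1.1 + 1)) (fine L (M (l.1.1 + 1))) (aK a L (l.1.1 + 1))
              (((L ^ (l.1.1 + 1) : ℕ) : ℝ) ^ 2) m2
            + (a * ((L : ℝ) ^ 2)⁻¹) • blockProj L (M (l.1.1 + 1)))⁻¹
          *ᵥ fun w => minimiser (L ^ (l.1.1 + 1)) (fine L (M (l.1.1 + 1))) (aK a L (l.1.1 + 1))
              (((L ^ (l.1.1 + 1) : ℕ) : ℝ) ^ 2) m2 (Pi.single w 1) (yA l)))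
    (fun _ _ l => (fun z => minimiser (L ^ n * L ^ (l.1.1 + 1)) (fine L (M (l.1.1 + 1))) (aK a L (l.1.1 + 1 + n))
        (((L ^ n * L ^ (l.1.1 + 1) : ℕ) : ℝ) ^ 2) m2 (Pi.single z 1) (xB l))
      ⬝ᵥ ((effLaplacian (L ^ n * L ^ (l.1.1 + 1)) (fine L (M (l.1.1 + 1))) (aK a L (l.1.1 + 1 + n))
              (((L ^ n * L ^ (l.1.1 + 1) : ℕ) : ℝ) ^ 2) m2
            + (a * ((L : ℝ) ^ 2)⁻¹) • blockProj L (M (l.1.1 + 1)))⁻¹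
          *ᵥ fun w => minimiser (L ^ n * L ^ (l.1.1 + 1)) (fine L (M (l.1.1 + 1))) (aK a L (l.1.1 + 1 + n))
              (((L ^ n * L ^ (l.1.1 + 1) : ℕ) : ℝ) ^ 2) m2 (Pi.single w 1) (yB l)))
    (fun _ _ _ => rfl) (fun _ _ _ => rfl) Set.univ
  -- every line of every domain is located at its domain: live lines by King's bound, dead lines read `0`
  have hline : ∀ X : Σ j : ℕ, TDom 4 (N j), ∀ pq ∈ X.2.1 ×ˢ X.2.1,
      |GA ⟨X, pq⟩ - GB ⟨X, pq⟩| ≤ C₅ * θ ^ X.1 * Real.exp (-(κ * ρ * torusTreeLen X.2.1)) := by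
    intro X pq _
    by_cases hl : live ⟨X, pq⟩
    · have hX := h5 (fun _ => 1) (Set.mem_univ _) PUnit.unit ⟨X, pq⟩
      beta_reduce at hX
      rw [← hGA _ hl, ← hGB _ hl] at hX
      have hsc : C'.scale ⟨X, pq⟩ = X.1 + 1 := rfl
      have hdX : C'.d ⟨X, pq⟩ = ρ * torusTreeLen X.2.1 := min_eq_left (hloc _ hl)
      rw [hsc, hdX] at hX
      refine hX.trans ?_
      rw [show κ * ρ * torusTreeLen X.2.1 = κ * (ρ * torusTreeLen X.2.1) by ring]
      refine mul_le_mul_of_nonneg_right (mul_le_mul_of_nonneg_left ?_ hC₅) (Real.exp_pos _).le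
      calc θ ^ (X.1 + 1) = θ ^ X.1 * θ := pow_succ θ X.1
        _ ≤ θ ^ X.1 * 1 := mul_le_mul_of_nonneg_left hθ1 (pow_nonneg hθ0 _)
        _ = θ ^ X.1 := mul_one _
    · rw [hdead _ hl, sub_self, abs_zero]
      positivity
  exact ne5_reFunctional_of_cubePairs N W KA KB (fun X pq => GA ⟨X, pq⟩) (fun X pq => GB ⟨X, pq⟩)
    (mul_pos hκ hρ) hθ0 hC₅ hK hline W'

/-- The letters of §2 have CONTENT: for `ρ > 0` the END's decay exponent `κρ∕2` is positive and the constant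
`C₅·(4·2^4)²·(2!(2∕(κρ))²e^{κρ∕2})` is non-negative; for `γ > 0` the rate `L^{−γ∕2}` lies in `]0, 1[`
(`N18KingModelEndDecay.endCarriers_decay_letters`). [cite: King1986, Prop. 3.9 (3.73) p.665] -/
theorem allLines_letters {κ ρ C₅ : ℝ} (hκ : 0 < κ) (hρ : 0 < ρ) (hC₅ : 0 ≤ C₅) {L : ℕ} (hL : 2 ≤ L) {γ : ℝ}
    (hγ : 0 < γ) :
    0 < κ * ρ / 2 ∧ 0 ≤ C₅ * (4 * 2 ^ 4) ^ 2 * (((2 : ℕ).factorial : ℝ) * (2 / (κ * ρ)) ^ 2 * Real.exp (κ * ρ / 2)) ∧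
      0 < (L : ℝ) ^ (-(γ / 2)) ∧ (L : ℝ) ^ (-(γ / 2)) < 1 := by
  obtain ⟨h1, h2, h3⟩ := N18KingModelEndDecay.endCarriers_decay_letters hκ hρ hL hγ
  exact ⟨by linarith, by positivity, h2, h3⟩
end AllLines

/-! ## §3 Non-vacuity: the selection reading (d = 4, ρ = 1∕4) — every pair of blocks is a live line of its selected domain -/

section Selection
/-- **THE SELECTION READING EXISTS AT EVERY SCALE** (`ρ = 1∕4`).  On the END's torus of unit cubes `(ℤ∕(L·M))^4` at scale
`j` — which IS King's unit torus of a Bałaban volume with `M_μ = M` (`TPt 4 (L·M) = Tor (fine L M)` definitionally) —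
there are a SELECTION of a localization domain `Xsel (p, q) ∈ 𝐃_j ∋ p, q` with `¼·d_j(Xsel (p, q)) ≤ |p − q|_{T₁}` for every
ordered pair of blocks (module 1 §3 `exists_live_domain`) and BASE-POINT readings — run B's `x_B (p, q) = L^nL^{j+1}·p` (the
corner of block `p` on King's level `j + 1 + n`), run A's `x_A (p, q) = L^{j+1}·p` under it, likewise `y_B, y_A` at `q` —
with `B(x_A (p, q)) = p`, `B(y_A (p, q)) = q` (`King1986.Torus.site` ∕ `val_site` ∕ `blockOf_site`).  Declaring a line
`(⟨j, X⟩, (p, q))` of §2 LIVE iff `X = Xsel (p, q)`, §2's binders `hx`, `hy`, `hloc` hold jointly with `ρ = 1∕4` and EVERY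
pair of blocks of the torus is a live line of exactly one domain: the «all pairs» activity carries every line of King's
(4.42) two-point graph exactly once, with a non-idle decay factor.
[cite: King1986, p.664 («x′ ∈ B^n(x)»), (4.42) p.675; Balaban1987RG1, p.257 (linear size d_j); Balaban1988RG2Cluster, (2.30) p.18 (upper half)] -/
theorem exists_selection_reading (L M : ℕ) [NeZero L] [NeZero M] (n j : ℕ) :
    ∃ (Xsel : TPt 4 (L * M) × TPt 4 (L * M) → TDom 4 (L * M))
      (xA yA : TPt 4 (L * M) × TPt 4 (L * M) → Tor (fine (L ^ (j + 1)) (fine L (fun _ : Fin 4 => M))))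
      (xB yB : TPt 4 (L * M) × TPt 4 (L * M) → Tor (fine (L ^ n * L ^ (j + 1)) (fine L (fun _ : Fin 4 => M)))),
      (∀ pq, pq.1 ∈ (Xsel pq).1 ∧ pq.2 ∈ (Xsel pq).1) ∧
      (∀ pq μ, (xA pq μ).val = (xB pq μ).val / L ^ n) ∧ (∀ pq μ, (yA pq μ).val = (yB pq μ).val / L ^ n) ∧
      (∀ pq, blockOf (L ^ (j + 1)) (fine L (fun _ : Fin 4 => M)) (xA pq) = pq.1 ∧
        blockOf (L ^ (j + 1)) (fine L (fun _ : Fin 4 => M)) (yA pq) = pq.2) ∧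
      (∀ pq, (1 / 4 : ℝ) * torusTreeLen (Xsel pq).1 ≤ tdistT (fine L (fun _ : Fin 4 => M))
        (blockOf (L ^ (j + 1)) (fine L (fun _ : Fin 4 => M)) (xA pq))
        (blockOf (L ^ (j + 1)) (fine L (fun _ : Fin 4 => M)) (yA pq))) := by
  have hL0 : 0 < L := Nat.pos_of_ne_zero (NeZero.ne L)
  have hLn : 0 < L ^ n := pow_pos hL0 n
  have hLj : 0 < L ^ (j + 1) := pow_pos hL0 (j + 1)
  have hLnj : 0 < L ^ n * L ^ (j + 1) := Nat.mul_pos hLn hLj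
  haveI : NeZero (L ^ (j + 1)) := ⟨hLj.ne'⟩
  haveI : NeZero (L ^ n * L ^ (j + 1)) := ⟨hLnj.ne'⟩
  -- a connecting domain for every pair of blocks (module 1 §3)
  choose Xs hXs using fun pq : TPt 4 (L * M) × TPt 4 (L * M) =>
    exists_live_domain L M pq.1 pq.2
  -- base points of the blocks on the two levels
  refine ⟨Xs,
    fun pq => site (L ^ (j + 1)) (fine L (fun _ : Fin 4 => M)) pq.1 (fun _ => ⟨0, hLj⟩),
    fun pq => site (L ^ (j + 1)) (fine L (fun _ : Fin 4 => M)) pq.2 (fun _ => ⟨0, hLj⟩),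
    fun pq => site (L ^ n * L ^ (j + 1)) (fine L (fun _ : Fin 4 => M)) pq.1 (fun _ => ⟨0, hLnj⟩),
    fun pq => site (L ^ n * L ^ (j + 1)) (fine L (fun _ : Fin 4 => M)) pq.2 (fun _ => ⟨0, hLnj⟩),
    fun pq => ⟨(hXs pq).1, (hXs pq).2.1⟩, fun pq μ => ?_, fun pq μ => ?_,
    fun pq => ⟨blockOf_site _ _ _ _, blockOf_site _ _ _ _⟩, fun pq => ?_⟩
  · rw [val_site, val_site]
    simp only [Nat.add_zero]
    rw [Nat.mul_assoc, Nat.mul_div_cancel_left _ hLn]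
  · rw [val_site, val_site]
    simp only [Nat.add_zero]
    rw [Nat.mul_assoc, Nat.mul_div_cancel_left _ hLn]
  · rw [blockOf_site, blockOf_site]
    exact (hXs pq).2.2
end Selection

/-! ## §4 Read-back: a line located at a domain is located in King's block distance -/

section ReadBack
variable {d N : ℕ} [NeZero N]

/-- **READ-BACK: THE TWO CURRENCIES AGREE AT THE LEVEL OF LINES.**  If a quantity `v` (e.g. the two-run difference of
King's (4.42) graph of the blocks `p, q`) is located at SOME domain `X ∈ 𝐃_j ∋ p, q`, `v ≤ C·θ^j·e^{−κ′·d_j(X)}`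
(`C, θ, κ′ ≥ 0`), then `v ≤ (C·e^{κ′(2^d − 1)∕(4·2^d)})·θ^j·e^{−(κ′∕(4·2^d))·|p − q|_{T₁}}` (§1
`tdistT_le_torusTreeLen_affine`).  With module 1 §1 `exists_connecting_tdom` (King's `e^{−κ|p − q|}` gives `e^{−(κ∕d)·d_j(X)}` at
the connecting domain) the dictionary «[King1986] (3.73)'s `e^{−δ₀|x − y|}` ↔ [Balaban1987RG1] (0.25)'s `e^{−κd_j(X)}`» is
two-way up to letters, line by line. [cite: King1986, Prop. 3.9 (3.73) p.665; Balaban1987RG1, (0.25) p.257; Balaban1988RG2Cluster, (2.30) p.18] -/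
theorem kingShape_of_locatedLine (X : TDom d N) {p q : TPt d N} (hp : p ∈ X.1) (hq : q ∈ X.1) {v C θ κ' : ℝ}
    (hC : 0 ≤ C) (hθ : 0 ≤ θ) (hκ : 0 ≤ κ') (j : ℕ) (hv : v ≤ C * θ ^ j * Real.exp (-(κ' * torusTreeLen X.1))) :
    v ≤ C * Real.exp (κ' * (2 ^ d - 1) / (4 * 2 ^ d)) * θ ^ j *
      Real.exp (-(κ' / (4 * 2 ^ d) * tdistT (fun _ : Fin d => N) p q)) := by
  have hgeo := tdistT_le_torusTreeLen_affine X hp hq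
  have h4 : (0 : ℝ) < 4 * 2 ^ d := by positivity
  have hexp : Real.exp (-(κ' * torusTreeLen X.1)) ≤
      Real.exp (κ' * (2 ^ d - 1) / (4 * 2 ^ d)) * Real.exp (-(κ' / (4 * 2 ^ d) * tdistT (fun _ : Fin d => N) p q)) := by
    rw [← Real.exp_add]
    apply Real.exp_le_exp.2
    have h1 := mul_le_mul_of_nonneg_left hgeo (div_nonneg hκ h4.le)
    have e : κ' / (4 * 2 ^ d) * (4 * 2 ^ d * torusTreeLen X.1 + (2 ^ d - 1))
        = κ' * torusTreeLen X.1 + κ' * (2 ^ d - 1) / (4 * 2 ^ d) := by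
      field_simp
    linarith
  calc v ≤ C * θ ^ j * Real.exp (-(κ' * torusTreeLen X.1)) := hv
    _ ≤ C * θ ^ j * (Real.exp (κ' * (2 ^ d - 1) / (4 * 2 ^ d))
          * Real.exp (-(κ' / (4 * 2 ^ d) * tdistT (fun _ : Fin d => N) p q))) :=
        mul_le_mul_of_nonneg_left hexp (mul_nonneg hC (pow_nonneg hθ _))
    _ = C * Real.exp (κ' * (2 ^ d - 1) / (4 * 2 ^ d)) * θ ^ j *
          Real.exp (-(κ' / (4 * 2 ^ d) * tdistT (fun _ : Fin d => N) p q)) := by ring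
end ReadBack

end Summit.QuantumFields.YangMills.BalabanUVNodes.N18KingModelAllLines

end
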